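import Literature.NumberTheory.LFunctions.FordVinogradovZRD
import Literature.NumberTheory.LFunctions.FordLemma32d0
import HarnessLib

/-!
# Incomplete Vinogradov systems: the mean-value representation and Hölder tools

Topic `Literature/NumberTheory/LFunctions`. Everything here is PROVED.

For Ford's §4 (K. Ford, Proc. LMS 85 (2002), Lemma 4.1–Theorem 4) one works with the
incomplete count `J_{s,k,h}(ℬ)` (`FordVK.Jinc k s ℬ h k`) of solutions of
`∑_{i≤s} (x_i^j − y_i^j) = 0` (`h ≤ j ≤ k`), `x_i, y_i ∈ ℬ`, and its exponential-sum form
`J_{s,k,h}(ℬ) = ∫_{[0,1]^k} |f(α)|^{2s} dα`, `f(α) = ∑_{x ∈ ℬ} e(α_h x^h + ⋯ + α_k x^k)`.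

* `FordVK.nuR`, `FordVK.integral_norm_tp_nuR_pow` — the representation above (we keep all `k`
  coordinates of `α`, the unused ones integrate out trivially);
* `FordVK.integral_norm_tp_two_nuR_pow` — doubling the frequencies does not change the count;
* Hölder corollaries on the box used in the four cases of Ford's Lemma 4.1:
  `FordVK.integral_pow_pred_le` (`∫|f|^{2s-1} ≤ (∫|f|^{2s})^{1-1/2s}`),
  `FordVK.integral_interpolate_le` (`J_{s-1} ≤ J_s^{1-1/(s-t)} J_t^{1/(s-t)}`).

## References

* K. Ford, Proc. London Math. Soc. (3) 85 (2002), 565–633, §4 (before Lemma 4.1). [Ford2002]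
* A. Ivić, *The Riemann Zeta-Function* (1985), §6.2 ((6.5)–(6.9): mean values count solutions).
  [Ivic1985]
-/

noncomputable section

open Finset MeasureTheory Complex
open scoped Real ComplexConjugate

namespace Literature.NumberTheory.LFunctions
namespace FordVK

open VMV

/-! ### The restricted frequency vector and `J_{s,k,[h,g]} = ∫ |f|^{2s}` -/

/-- The restricted monomial vector `ν_{[h,g]}(x) = (x^j · [h ≤ j ≤ g])_{j ≤ k}` (coordinate `j : Fin k`
standing for the exponent `j+1`). [cite: Ford2002, §4 (the sum `f(α; P, R)`)] -/
def nuR (k h g : ℕ) (x : ℤ) : Fin k → ℤ :=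
  fun j => if h ≤ j.val + 1 ∧ j.val + 1 ≤ g then x ^ (j.val + 1) else 0

/-- `s_{[h,g]}(X) = ∑_i ν_{[h,g]}(X_i)`. [folklore] -/
theorem psvR_eq_sum_nuR (k h g : ℕ) {s : ℕ} (X : Fin s → ℤ) :
    psvR k h g X = ∑ i, nuR k h g (X i) := by
  funext j
  simp only [psvR, psv, nuR, Finset.sum_apply]
  split_ifs <;> simp

/-- `∑_{X ∈ ℬ^s} e(α · s_{[h,g]}(X)) = f(α)^s`. [folklore] -/
theorem tp_tuples_psvR (k h g s : ℕ) (B : Finset ℤ) (α : Fin k → ℝ) :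
    tp (tuples s B) (psvR k h g) α = (tp B (nuR k h g) α) ^ s := by
  have hh := prod_tp_eq (n := k) (m := s) (fun _ => B) (fun _ => nuR k h g) α
  rw [prod_const, card_univ, Fintype.card_fin] at hh
  rw [hh]
  unfold tuples
  congr 1
  funext X
  exact psvR_eq_sum_nuR k h g X

/-- **`J_{s,k,[h,g]}(ℬ) = ∫_{[0,1]^k} |f(α)|^{2s} dα`.** [cite: Ford2002, §4 (display before Lemma 4.1)] -/
theorem integral_norm_tp_nuR_pow (k h g s : ℕ) (B : Finset ℤ) :
    ∫ α in box k, ‖tp B (nuR k h g) α‖ ^ (2 * s) = (Jinc k s B h g : ℝ) := by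
  rw [show (fun α => ‖tp B (nuR k h g) α‖ ^ (2 * s)) = fun α => ‖(tp B (nuR k h g) α) ^ s‖ ^ 2 by
    funext α; rw [norm_pow, ← pow_mul, mul_comm]]
  simp_rw [← tp_tuples_psvR]
  rw [integral_norm_sq_tp]
  unfold Jinc solCount
  congr 2
  refine Finset.filter_congr fun xy _ => ?_
  rw [add_zero]

/-- `∑_{X ∈ ℬ^s} e(α · 2 s_{[h,g]}(X)) = f₂(α)^s` for the doubled frequencies. [folklore] -/
theorem tp_tuples_two_psvR (k h g s : ℕ) (B : Finset ℤ) (α : Fin k → ℝ) :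
    tp (tuples s B) (fun X => 2 • psvR k h g X) α = (tp B (fun x => 2 • nuR k h g x) α) ^ s := by
  have hh := prod_tp_eq (n := k) (m := s) (fun _ => B) (fun _ => fun x => 2 • nuR k h g x) α
  rw [prod_const, card_univ, Fintype.card_fin] at hh
  rw [hh]
  unfold tuples
  congr 1
  funext X
  rw [psvR_eq_sum_nuR, Finset.smul_sum]

/-- **Doubling does not change the count**: `∫ |f₂|^{2s} = J_{s,k,[h,g]}(ℬ)`.
[cite: Ford2002, proof of Lemma 4.1 (case S₂: `∫|f(2α)|^{2s} = ∫|f(α)|^{2s}`)] -/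
theorem integral_norm_tp_two_nuR_pow (k h g s : ℕ) (B : Finset ℤ) :
    ∫ α in box k, ‖tp B (fun x => 2 • nuR k h g x) α‖ ^ (2 * s) = (Jinc k s B h g : ℝ) := by
  rw [show (fun α => ‖tp B (fun x => 2 • nuR k h g x) α‖ ^ (2 * s))
      = fun α => ‖(tp B (fun x => 2 • nuR k h g x) α) ^ s‖ ^ 2 by
    funext α; rw [norm_pow, ← pow_mul, mul_comm]]
  simp_rw [← tp_tuples_two_psvR]
  rw [integral_norm_sq_tp]
  unfold Jinc solCount
  congr 2
  refine Finset.filter_congr fun xy _ => ?_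
  rw [add_zero]
  constructor
  · intro h2
    exact smul_right_injective (Fin k → ℤ) two_ne_zero h2
  · intro h1; rw [h1]

/-- The diagonal solutions: `J_{s,k,[h,g]}(ℬ) ≥ |ℬ|^s`. [cite: Ford2002, (4.4)] -/
theorem card_pow_le_Jinc (k h g s : ℕ) (B : Finset ℤ) : B.card ^ s ≤ Jinc k s B h g := by
  classical
  unfold Jinc solCount
  rw [← card_tuples s B]
  refine Finset.card_le_card_of_injOn (fun X => (X, X)) (fun X hX => ?_) (fun X _ Y _ hXY => ?_)
  · rw [mem_coe, mem_filter, mem_product]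
    exact ⟨⟨hX, hX⟩, by rw [add_zero]⟩
  · exact (Prod.mk.inj hXY).1

/-! ### Hölder corollaries on `[0,1]^k` -/

/-- The unit box has volume `1`. [folklore] -/
theorem volume_box (n : ℕ) : volume (box n) = 1 := by
  rw [show box n = Set.univ.pi (fun _ : Fin n => Set.Icc (0 : ℝ) 1) from rfl, volume_pi_pi]
  simp [Real.volume_Icc]

/-- `∫_{[0,1]^n} 1 = 1`. [folklore] -/
theorem integral_box_one (n : ℕ) : ∫ _ in box n, (1 : ℝ) = 1 := by
  rw [setIntegral_const, smul_eq_mul, mul_one, Measure.real, volume_box, ENNReal.toReal_one]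

/-- **Monotonicity of power means** on the unit box: `∫ F^a ≤ (∫ F^b)^{a/b}` for continuous `F ≥ 0`
and `0 < a < b` (Hölder with `G = 1`). [folklore] -/
theorem integral_rpow_le_rpow_integral {n : ℕ} {F : (Fin n → ℝ) → ℝ} (hF : Continuous F)
    (hF0 : ∀ α, 0 ≤ F α) {a b : ℝ} (ha : 0 < a) (hab : a < b) :
    ∫ α in box n, F α ^ a ≤ (∫ α in box n, F α ^ b) ^ (a / b) := by
  have hb : 0 < b := ha.trans hab
  have hpq : (b / a).HolderConjugate (b / (b - a)) := by
    rw [Real.holderConjugate_iff]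
    refine ⟨?_, ?_⟩
    · rw [one_lt_div ha]; exact hab
    · have : b - a ≠ 0 := by linarith
      field_simp; ring
  have h := holder_box (F := fun α => F α ^ a) (G := fun _ => (1 : ℝ))
    (hF.rpow_const fun _ => Or.inr ha.le) continuous_const (fun α => Real.rpow_nonneg (hF0 α) _)
    (fun _ => zero_le_one) hpq
  simp only [mul_one, Real.one_rpow, integral_box_one] at h
  have e1 : ∀ α, (F α ^ a) ^ (b / a) = F α ^ b := fun α => by
    rw [← Real.rpow_mul (hF0 α)]; congr 1; field_simp
  simp_rw [e1, one_div_div] at h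
  exact h

/-- **Log-convexity of moments** on the unit box: for continuous `F ≥ 0`, `0 ≤ a`, `0 ≤ b` and
`0 < θ < 1`, `∫ F^{θa+(1-θ)b} ≤ (∫ F^a)^θ (∫ F^b)^{1-θ}` (Hölder with exponents `1/θ, 1/(1-θ)`); this is
the interpolation `J_{s-1} ≤ J_t^{1/(s-t)} J_s^{1-1/(s-t)}` of Ford's case `S₃`.
[cite: Ford2002, proof of Lemma 4.1 (last display of case S₃)] -/
theorem integral_rpow_interpolate_le {n : ℕ} {F : (Fin n → ℝ) → ℝ} (hF : Continuous F)
    (hF0 : ∀ α, 0 ≤ F α) {a b θ : ℝ} (ha : 0 ≤ a) (hb : 0 ≤ b) (hθ0 : 0 < θ) (hθ1 : θ < 1) :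
    ∫ α in box n, F α ^ (θ * a + (1 - θ) * b)
      ≤ (∫ α in box n, F α ^ a) ^ θ * (∫ α in box n, F α ^ b) ^ (1 - θ) := by
  have hθ1' : 1 - θ ≠ 0 := by linarith
  have hpq : (1 / θ).HolderConjugate (1 / (1 - θ)) := by
    rw [Real.holderConjugate_iff]
    refine ⟨?_, ?_⟩
    · rw [one_lt_div hθ0]; linarith
    · field_simp; ring
  have h := holder_box (F := fun α => F α ^ (θ * a)) (G := fun α => F α ^ ((1 - θ) * b))
    (hF.rpow_const fun _ => Or.inr (by positivity)) (hF.rpow_const fun _ => Or.inr (by nlinarith))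
    (fun α => Real.rpow_nonneg (hF0 α) _) (fun α => Real.rpow_nonneg (hF0 α) _) hpq
  have e0 : ∀ α, F α ^ (θ * a) * F α ^ ((1 - θ) * b) = F α ^ (θ * a + (1 - θ) * b) := fun α => by
    by_cases hsum : θ * a + (1 - θ) * b = 0
    · -- then `a = 0` and `b = 0`
      have ha0 : a = 0 := by nlinarith
      have hb0 : b = 0 := by nlinarith
      simp [ha0, hb0]
    · rw [← Real.rpow_add' (hF0 α) hsum]
  have e1 : ∀ α, (F α ^ (θ * a)) ^ (1 / θ) = F α ^ a := fun α => by
    rw [← Real.rpow_mul (hF0 α)]; congr 1; field_simp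
  have e2 : ∀ α, (F α ^ ((1 - θ) * b)) ^ (1 / (1 - θ)) = F α ^ b := fun α => by
    rw [← Real.rpow_mul (hF0 α)]; congr 1; field_simp
  simp_rw [e0, e1, e2, one_div_one_div] at h
  exact h

/-- **Cauchy–Schwarz on the unit box** for continuous nonnegative `F, G`. [folklore] -/
theorem integral_mul_le_sqrt {n : ℕ} {F G : (Fin n → ℝ) → ℝ} (hF : Continuous F) (hG : Continuous G)
    (hF0 : ∀ α, 0 ≤ F α) (hG0 : ∀ α, 0 ≤ G α) :
    ∫ α in box n, F α * G α
      ≤ (∫ α in box n, F α ^ 2) ^ (1 / 2 : ℝ) * (∫ α in box n, G α ^ 2) ^ (1 / 2 : ℝ) := by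
  have h := holder_box hF hG hF0 hG0 Real.HolderConjugate.two_two
  simp_rw [Real.rpow_two] at h
  exact h


end FordVK
end Literature.NumberTheory.LFunctions
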